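import Literature.Geometry.Lorentzian.TameFamilyOffCompact
import HarnessLib

/-!
# The ADM energy of an end is determined by the data outside any compact set

A data set `D'` on `X` whose metric agrees with that of `D` on a far region `e.far R₀` of an
asymptotically flat end `e` (in particular: any compactly supported modification of `D`, by
`AFEnd.exists_forall_far_disjoint`) has, on `e`, the SAME ADM energy fluxes through every coordinate
sphere of radius `r > max R₀ e.R`, hence the same honest ADM energy statement `HasADMEnergy e · m`
for every `m`, and the same `admEnergy` (including Mathlib's junk value of `limUnder` when the limit
does not exist: `limUnder` of eventually equal functions). This is the bookkeeping behind
Christodoulou's compactly supported witness lines `α₀ + c f` (CQG 16 (1999) A23, p. A24: "f of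
compact support", so that the mass at infinity is read off unchanged) and behind every local
gluing construction (Corvino–Schoen, Chruściel–Delay: the data are untouched near infinity):

* `AFEnd.partialH_eq_of_agree_far` — the coordinate derivatives `∂ₗ h_ij` agree beyond
  `max R₀ e.R` (`hCoeff_eq_of_agree_far` on the open exterior region, locality of `fderiv`);
* `AFEnd.admEnergyFlux_eq_of_agree_far`, `AFEnd.admEnergyFlux_eventuallyEq_of_agree_far` —
  the fluxes `E(r)` agree for `r > max R₀ e.R`;
* `AFEnd.hasADMEnergy_iff_of_agree_far`, `AFEnd.admEnergy_eq_of_agree_far` — the energy;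
* `InitialDataSet.hasADMEnergy_iff_of_agree_off_compact`,
  `InitialDataSet.admEnergy_eq_of_agree_off_compact` — the compact-support form, on EVERY end.

Arnowitt–Deser–Misner 1962; Bartnik, CPAM 39 (1986) 661, (4.2) and §4 (the energy as a limit of
far-sphere fluxes, insensitive to the interior). Everything here is proved; no definitions, no named
facts.
-/

noncomputable section

open Set Function Filter Metric TopologicalSpace
open scoped Manifold ContDiff Topology

namespace Literature.Geometry.Lorentzian

namespace AFEnd

variable {X : Type} [TopologicalSpace X] [ChartedSpace E3 X] [IsManifold (𝓡 3) ∞ X]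

/-- **Coordinate derivatives of the chart components agree beyond a radius** when the metrics of
`D'` and `D` agree on the far region `e.far R₀`: `∂ₗ h'_ij (z) = ∂ₗ h_ij (z)` for
`max R₀ e.R < ‖z‖` (the components agree on the open set `{max R₀ e.R < ‖·‖} ∋ z`,
`hCoeff_eq_of_agree_far`, and `fderiv` is local). Bartnik 1986, (1.3), (4.2). [cite: Bartnik1986, (4.2)] -/
theorem partialH_eq_of_agree_far (e : AFEnd X) {D D' : InitialDataSet (𝓡 3) X} {R₀ : ℝ}
    (hh : ∀ q ∈ e.far R₀, D'.h.inner q = D.h.inner q) {z : E3} (hz : max R₀ e.R < ‖z‖)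
    (l i j : Fin 3) : partialH e D' l i j z = partialH e D l i j z := by
  have hev : (fun y ↦ hCoeff e D' y (EuclideanSpace.single i 1) (EuclideanSpace.single j 1)) =ᶠ[𝓝 z]
      fun y ↦ hCoeff e D y (EuclideanSpace.single i 1) (EuclideanSpace.single j 1) := by
    filter_upwards [(isOpen_lt continuous_const continuous_norm).mem_nhds hz] with y hy
    rw [e.hCoeff_eq_of_agree_far hh hy]
  unfold partialH
  rw [hev.fderiv_eq]

/-- **ADM energy fluxes agree beyond the region of disagreement**: if the metrics of `D'` and `D`
agree on `e.far R₀`, then `E'(r) = E(r)` for every `r > max R₀ e.R` (the flux integrand on the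
sphere `‖x‖ = r` only involves `∂h` there). Bartnik 1986, (4.2). [cite: Bartnik1986, (4.2)] -/
theorem admEnergyFlux_eq_of_agree_far (e : AFEnd X) {D D' : InitialDataSet (𝓡 3) X} {R₀ : ℝ}
    (hh : ∀ q ∈ e.far R₀, D'.h.inner q = D.h.inner q) {r : ℝ} (hr : max R₀ e.R < r) :
    admEnergyFlux e D' r = admEnergyFlux e D r := by
  unfold admEnergyFlux
  congr 1
  refine MeasureTheory.setIntegral_congr_fun isClosed_sphere.measurableSet fun x hx ↦ ?_
  have hx' : max R₀ e.R < ‖x‖ := by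
    rw [mem_sphere_zero_iff_norm.1 hx]
    exact hr
  simp only [partialH_eq_of_agree_far e hh hx']

/-- The flux functions are **eventually equal** as `r → ∞`. Bartnik 1986, (4.2). [cite: Bartnik1986, (4.2)] -/
theorem admEnergyFlux_eventuallyEq_of_agree_far (e : AFEnd X) {D D' : InitialDataSet (𝓡 3) X}
    {R₀ : ℝ} (hh : ∀ q ∈ e.far R₀, D'.h.inner q = D.h.inner q) :
    admEnergyFlux e D' =ᶠ[atTop] admEnergyFlux e D := by
  filter_upwards [eventually_gt_atTop (max R₀ e.R)] with r hr
  exact admEnergyFlux_eq_of_agree_far e hh hr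

/-- **The honest ADM energy statement is insensitive to the interior**: `HasADMEnergy e D' m ↔
HasADMEnergy e D m` when the metrics agree on a far region. Bartnik 1986, §4. [cite: Bartnik1986, §4] -/
theorem hasADMEnergy_iff_of_agree_far (e : AFEnd X) {D D' : InitialDataSet (𝓡 3) X} {R₀ : ℝ}
    (hh : ∀ q ∈ e.far R₀, D'.h.inner q = D.h.inner q) (m : ℝ) :
    HasADMEnergy e D' m ↔ HasADMEnergy e D m :=
  tendsto_congr' (admEnergyFlux_eventuallyEq_of_agree_far e hh)

/-- **The ADM energy is insensitive to the interior** (`admEnergy` form, junk values included: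
`limUnder atTop` of eventually equal functions coincide). Arnowitt–Deser–Misner 1962; Bartnik
1986, §4. [cite: ArnowittDeserMisner1962] -/
theorem admEnergy_eq_of_agree_far (e : AFEnd X) {D D' : InitialDataSet (𝓡 3) X} {R₀ : ℝ}
    (hh : ∀ q ∈ e.far R₀, D'.h.inner q = D.h.inner q) :
    admEnergy e D' = admEnergy e D := by
  unfold admEnergy limUnder
  rw [map_congr (admEnergyFlux_eventuallyEq_of_agree_far e hh)]

end AFEnd

namespace InitialDataSet

variable {X : Type} [TopologicalSpace X] [ChartedSpace E3 X] [IsManifold (𝓡 3) ∞ X]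

/-- **A compactly supported modification of the metric does not change the ADM energy statement on
any end**: if `D'.h = D.h` outside a compact `K ⊆ X`, then for every asymptotically flat end `e` of
`X` and every `m`, `HasADMEnergy e D' m ↔ HasADMEnergy e D m` (some far region of `e` misses `K`,
`AFEnd.exists_forall_far_disjoint`). Christodoulou, CQG 16 (1999) A23, p. A24; Bartnik 1986, §4. [cite: Christodoulou1999, p. A24] -/
theorem hasADMEnergy_iff_of_agree_off_compact {D D' : InitialDataSet (𝓡 3) X} {K : Set X}
    (hK : IsCompact K) (hh : ∀ x ∉ K, D'.h.inner x = D.h.inner x) (e : AFEnd X) (m : ℝ) :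
    AFEnd.HasADMEnergy e D' m ↔ AFEnd.HasADMEnergy e D m := by
  obtain ⟨R₀, hR₀⟩ := e.exists_forall_far_disjoint hK
  exact e.hasADMEnergy_iff_of_agree_far
    (fun q hq ↦ hh q (Set.disjoint_left.1 (hR₀ R₀ le_rfl) hq)) m

/-- The `admEnergy` form of the same: `admEnergy e D' = admEnergy e D` on every end. [cite: Christodoulou1999, p. A24] -/
theorem admEnergy_eq_of_agree_off_compact {D D' : InitialDataSet (𝓡 3) X} {K : Set X}
    (hK : IsCompact K) (hh : ∀ x ∉ K, D'.h.inner x = D.h.inner x) (e : AFEnd X) :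
    AFEnd.admEnergy e D' = AFEnd.admEnergy e D := by
  obtain ⟨R₀, hR₀⟩ := e.exists_forall_far_disjoint hK
  exact e.admEnergy_eq_of_agree_far (fun q hq ↦ hh q (Set.disjoint_left.1 (hR₀ R₀ le_rfl) hq))

end InitialDataSet

end Literature.Geometry.Lorentzian

end
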